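import Summits.Ventures.WeilGRH.UniformConductorFloorMinorantLimit
import Summits.Ventures.WeilGRH.GeneralTransfer
import HarnessLib

/-!
# GRH arm (rh-explicit, venture WeilGRH): the EVEN pseudo-key minorises every character (any parity)

Cell `rh-explicit`, WEIL TRACK — GRH ARM (weil-grh-1).  `UniformConductorFloorMinorant(Limit).lean` minorise `Re Q_χ(g)`
by the all-trivial-key form of the SAME parity as `χ`.  Since the parity term of Weil's functional is non-negative
(`re_parity_term_nonneg`: `A_{a_χ}(g ⋆ g̃) ≥ A_0(g ⋆ g̃)`), the EVEN pseudo-key form (`x = ¼`) minorises every character: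
**`T^{(¼)}_M(|g|) ≤ Re Q_χ(g)` and `T^{(¼)}(|g|) ≤ Re Q_χ(g)` for EVERY Dirichlet character `χ` mod `q ≠ 1`**
(`re_weilQuadraticChar_ge_trivialKeyFormTrunc_quarter`, `re_weilQuadraticChar_ge_trivialKeyForm_quarter`), hence ONE
certificate — positivity of the even pseudo-key form at conductor `Q₀` on the functions `|g|` — gives
`WeilPositivityOnChar χ t` for EVERY character of EVERY modulus `q ≥ Q₀` (`weilPositivityOnChar_of_trivialKeyForm_quarter_nonneg`;
the cell's certified value at `t = 1` is `Q₀ = 75`, exact — weil-grh-2, GRH/trivial-key-minorant-CERT).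

## References

* A. Weil (1952), (11) with (5), (10) and the «lemme» p. 262 [Weil1952FormulesExplicites].
-/

noncomputable section

open Complex Filter Set MeasureTheory
open scoped Real Topology ComplexConjugate ArithmeticFunction.vonMangoldt

namespace Summit.Ventures.WeilGRH

open Literature.NumberTheory.LFunctions

namespace UniformFloor

variable {g : ℝ → ℂ}

/-- **THE EVEN PSEUDO-KEY MINORISES EVERY CHARACTER** (`M` layers): for every `χ` mod `q ≠ 1` (any parity), every test
`g` supported in `[-t, t]`, `e^{2t} ≤ N + 1` and every `M`: `trivialKeyFormTrunc ¼ q N M |g| ≤ Re Q_χ(g)`.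
[cite: Weil1952FormulesExplicites, (11) pp. 261–262 and the «lemme» p. 262] -/
theorem re_weilQuadraticChar_ge_trivialKeyFormTrunc_quarter {q : ℕ} (hq : q ≠ 1) (χ : DirichletCharacter ℂ q)
    (hg : IsWeilTest g) {t : ℝ} (hsupp : tsupport g ⊆ Icc (-t) t) {N : ℕ}
    (hN : Real.exp (2 * t) ≤ (N : ℝ) + 1) (M : ℕ) :
    trivialKeyFormTrunc (1 / 4) q N M (fun y ↦ ‖g y‖) ≤ (weilQuadraticChar χ g).re := by
  set k := weilConv g (weilReflect g) with hk
  set N2 := weilNorm2Sq g with hN2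
  set x : ℝ := 1 / 4 with hx
  have hx0 : 0 < x := by norm_num
  set W : ℝ → ℝ := fun τ ↦ ‖weilMellin g (1 / 2 + τ * I)‖ ^ 2 with hW
  set A : ℝ := ∫ τ : ℝ, W τ * (digamma ((x : ℂ) + ((τ / 2 : ℝ) : ℂ) * I)).re with hA
  -- the EVEN-parity archimedean integral minorises the one of `χ` (parity term `≥ 0`)
  have hre : -(weilPrimeTermChar χ k).re + (1 / (2 * π) * A + N2 * (Real.log q - Real.log π)) ≤
      (weilQuadraticChar χ g).re := by
    have hdec := weilQuadraticChar_eq_neg_prime_add hq χ rfl hg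
    have hpar := re_parity_term_nonneg χ hg
    rw [← hk, weilArchIntegralChar_weilConv_weilReflect hg (charParity χ),
      weilArchIntegralChar_weilConv_weilReflect hg 0] at hpar
    have hπ : ((1 / (2 * π) : ℂ)) = ((1 / (2 * π) : ℝ) : ℂ) := by push_cast; ring
    rw [hπ, ← Complex.ofReal_sub, ← Complex.ofReal_mul, Complex.ofReal_re] at hpar
    have hA0 : A = ∫ τ : ℝ, ‖weilMellin g (1 / 2 + τ * I)‖ ^ 2 *
        (digamma (1 / 4 + ((0 : ℕ) : ℂ) / 2 + τ / 2 * I)).re := by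
      rw [hA]
      refine integral_congr_ae (Eventually.of_forall fun τ ↦ ?_)
      simp only [hW, hx]
      congr 3
      push_cast
      ring
    have hAκ : (weilQuadraticChar χ g).re = -(weilPrimeTermChar χ k).re +
        (1 / (2 * π) * (∫ τ : ℝ, ‖weilMellin g (1 / 2 + τ * I)‖ ^ 2 *
          (digamma ((((1 / 4 + ((charParity χ : ℕ) : ℝ) / 2 : ℝ)) : ℂ) + ((τ / 2 : ℝ) : ℂ) * I)).re) +
          N2 * (Real.log q - Real.log π)) := by
      rw [hdec, Complex.add_re, Complex.neg_re, Complex.ofReal_re]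
    have hAκ' : (∫ τ : ℝ, ‖weilMellin g (1 / 2 + τ * I)‖ ^ 2 *
          (digamma ((((1 / 4 + ((charParity χ : ℕ) : ℝ) / 2 : ℝ)) : ℂ) + ((τ / 2 : ℝ) : ℂ) * I)).re) =
        ∫ τ : ℝ, ‖weilMellin g (1 / 2 + τ * I)‖ ^ 2 *
          (digamma (1 / 4 + ((charParity χ : ℕ) : ℂ) / 2 + τ / 2 * I)).re := by
      refine integral_congr_ae (Eventually.of_forall fun τ ↦ ?_)
      simp only
      congr 3
      push_cast
      ring
    rw [hAκ'] at hAκ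
    rw [hAκ, hA0]
    have hπ0 : 0 < 1 / (2 * π) := by positivity
    nlinarith
  have hN2eq : (∫ y : ℝ, ‖g y‖ ^ 2) = N2 := rfl
  -- (P) the prime side
  have hgc : Continuous g := hg.1.continuous
  have hkc : Continuous k := (hg.weilConv hg.weilReflect).1.continuous
  have hks : tsupport k ⊆ Icc (-(2 * t)) (2 * t) := tsupport_weilConv_weilReflect_subset hg.2 hsupp
  have hP : (weilPrimeTermChar χ k).re ≤
      ∑ n ∈ Finset.range (N + 1), (Λ n : ℝ) / Real.sqrt n * (2 * ∫ y : ℝ, ‖g y‖ * ‖g (y - Real.log n)‖) := by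
    refine (Complex.re_le_norm _).trans ?_
    rw [weilPrimeTermChar_eq_sum_of_tsupport_subset χ hkc hN hks]
    refine (norm_sum_le _ _).trans (Finset.sum_le_sum fun n _ ↦ ?_)
    have hΛ : 0 ≤ (Λ n : ℝ) / Real.sqrt n :=
      div_nonneg ArithmeticFunction.vonMangoldt_nonneg (Real.sqrt_nonneg _)
    have hcoef : ‖((Λ n : ℝ) : ℂ) / (Real.sqrt n : ℂ)‖ = (Λ n : ℝ) / Real.sqrt n := by
      rw [← Complex.ofReal_div, Complex.norm_real, Real.norm_of_nonneg hΛ]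
    have hχ : ‖χ (n : ZMod q)‖ ≤ 1 := DirichletCharacter.norm_le_one χ _
    have hneg : ‖k (-Real.log n)‖ = ‖k (Real.log n)‖ := by
      rw [hk, weilConv_weilReflect_neg, Complex.norm_conj]
    have hkL : ‖k (Real.log n)‖ ≤ ∫ y : ℝ, ‖g y‖ * ‖g (y - Real.log n)‖ :=
      norm_weilConv_weilReflect_le_integral_mul g _
    rw [norm_mul, hcoef]
    refine mul_le_mul_of_nonneg_left ?_ hΛ
    refine (norm_add_le _ _).trans ?_
    rw [norm_mul, norm_mul, Complex.norm_conj, hneg]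
    have hk0 : 0 ≤ ‖k (Real.log n)‖ := norm_nonneg _
    nlinarith [mul_le_mul_of_nonneg_right hχ hk0]
  -- (A) the archimedean side with `M` layers
  have hpt : ∀ τ : ℝ, W τ * ((digamma (x : ℂ)).re) + ∑ m ∈ Finset.range M,
      W τ * (1 / ((m : ℝ) + x) - ((m : ℝ) + x) / (((m : ℝ) + x) ^ 2 + (τ / 2) ^ 2)) ≤
      W τ * (digamma ((x : ℂ) + ((τ / 2 : ℝ) : ℂ) * I)).re := by
    intro τ
    have h := re_digamma_ge_sum x hx0 M τ
    have hW0 : 0 ≤ W τ := by positivity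
    rw [← Finset.mul_sum, ← mul_add]
    exact mul_le_mul_of_nonneg_left h hW0
  have hIW : Integrable W := integrable_norm_sq_weilMellin_half_line hg
  have hIψ : Integrable fun τ : ℝ ↦ W τ * (digamma ((x : ℂ) + ((τ / 2 : ℝ) : ℂ) * I)).re := by
    refine (integrable_norm_sq_weilMellin_mul_re_digamma hg hx0).congr (Eventually.of_forall fun τ ↦ ?_)
    simp only [hW]
    congr 3
    push_cast
    ring
  have hIm : ∀ m : ℕ, Integrable fun τ : ℝ ↦
      W τ * (1 / ((m : ℝ) + x) - ((m : ℝ) + x) / (((m : ℝ) + x) ^ 2 + (τ / 2) ^ 2)) := by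
    intro m
    have hl : 0 < (m : ℝ) + x := by positivity
    have h1 : Integrable fun τ : ℝ ↦ W τ * (((m : ℝ) + x) / (((m : ℝ) + x) ^ 2 + (τ / 2) ^ 2)) :=
      integrable_norm_sq_weilMellin_mul hg (continuous_lorentz hl).measurable (A := 1 / ((m : ℝ) + x)) (B := 0)
        (by positivity) le_rfl fun τ ↦ by
          rw [abs_of_nonneg (lorentz_nonneg hl τ), zero_mul, add_zero]
          exact lorentz_le hl τ
    refine ((hIW.mul_const (1 / ((m : ℝ) + x))).sub h1).congr (Eventually.of_forall fun τ ↦ ?_)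
    simp only [Pi.sub_apply]
    ring
  have hint := integral_mono
    (f := fun τ : ℝ ↦ W τ * ((digamma (x : ℂ)).re) + ∑ m ∈ Finset.range M,
      W τ * (1 / ((m : ℝ) + x) - ((m : ℝ) + x) / (((m : ℝ) + x) ^ 2 + (τ / 2) ^ 2)))
    ((hIW.mul_const _).add (integrable_finsetSum _ fun m _ ↦ hIm m)) hIψ hpt
  rw [integral_add (hIW.mul_const _) (integrable_finsetSum _ fun m _ ↦ hIm m), integral_mul_const,
    integral_finsetSum _ (fun m _ ↦ hIm m), integral_norm_sq_weilMellin_half_line hg] at hint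
  -- each layer in position space, dominated by the `|g|`-layer
  have hlayer : ∀ m ∈ Finset.range M,
      2 * π * ∫ u : ℝ, Real.exp (-(2 * ((m : ℝ) + x) * |u|)) * (N2 - ∫ y : ℝ, ‖g y‖ * ‖g (y - u)‖) ≤
        ∫ τ : ℝ, W τ * (1 / ((m : ℝ) + x) - ((m : ℝ) + x) / (((m : ℝ) + x) ^ 2 + (τ / 2) ^ 2)) := by
    intro m _
    have hl : 0 < (m : ℝ) + x := by positivity
    have h1 := layer_eq_integral hg hl
    have h2 := layer_ge_abs hg hl
    have hπ : 0 < 2 * π := by positivity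
    rw [← hN2, ← hk] at h1 h2
    have e : ∫ τ : ℝ, W τ * (1 / ((m : ℝ) + x) - ((m : ℝ) + x) / (((m : ℝ) + x) ^ 2 + (τ / 2) ^ 2)) =
        2 * π * ∫ u : ℝ, Real.exp (-(2 * ((m : ℝ) + x) * |u|)) * (N2 - (k u).re) := by
      rw [← h1, ← mul_assoc, mul_one_div_cancel (ne_of_gt hπ), one_mul]
    rw [e]
    exact mul_le_mul_of_nonneg_left h2 hπ.le
  have hsumlayer := Finset.sum_le_sum hlayer
  rw [← Finset.mul_sum] at hsumlayer
  -- assemble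
  have hπ : 0 < 2 * π := by positivity
  have hAge : ((digamma (x : ℂ)).re) * N2 + ∑ m ∈ Finset.range M,
      ∫ u : ℝ, Real.exp (-(2 * ((m : ℝ) + x) * |u|)) * (N2 - ∫ y : ℝ, ‖g y‖ * ‖g (y - u)‖) ≤ 1 / (2 * π) * A := by
    rw [show 1 / (2 * π) * A = A / (2 * π) by ring, le_div_iff₀ hπ]
    have : (2 * π * N2) * (digamma (x : ℂ)).re + 2 * π * ∑ m ∈ Finset.range M,
        ∫ u : ℝ, Real.exp (-(2 * ((m : ℝ) + x) * |u|)) * (N2 - ∫ y : ℝ, ‖g y‖ * ‖g (y - u)‖) ≤ A :=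
      le_trans (by linarith) hint
    linarith
  simp only [trivialKeyFormTrunc]
  rw [hN2eq]
  linarith [hAge, hP, hre]


/-- **… with Weil's full kernel**: `trivialKeyForm ¼ q N |g| ≤ Re Q_χ(g)` for every `χ` mod `q ≠ 1` (any parity).
[cite: Weil1952FormulesExplicites, (11) pp. 261–262 and the «lemme» p. 262] -/
theorem re_weilQuadraticChar_ge_trivialKeyForm_quarter {q : ℕ} (hq : q ≠ 1) (χ : DirichletCharacter ℂ q)
    (hg : IsWeilTest g) {t : ℝ} (hsupp : tsupport g ⊆ Icc (-t) t) {N : ℕ}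
    (hN : Real.exp (2 * t) ≤ (N : ℝ) + 1) :
    trivialKeyForm (1 / 4) q N (fun y ↦ ‖g y‖) ≤ (weilQuadraticChar χ g).re := by
  set N2 : ℝ := ∫ y : ℝ, ‖g y‖ ^ 2 with hN2
  set F : ℝ → ℝ := fun u ↦ N2 - ∫ y : ℝ, ‖g y‖ * ‖g (y - u)‖ with hF
  set C : ℝ := (Real.log q - Real.log π + (digamma ((1 / 4 : ℝ) : ℂ)).re) * N2 with hC
  set P : ℝ := ∑ n ∈ Finset.range (N + 1), (Λ n : ℝ) / Real.sqrt n *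
    (2 * ∫ y : ℝ, ‖g y‖ * ‖g (y - Real.log n)‖) with hP
  set a : ℕ → ℝ := fun m ↦ ∫ u : ℝ, Real.exp (-(2 * ((m : ℝ) + 1 / 4) * |u|)) * F u with ha
  have hT : ∀ M : ℕ, C + ∑ m ∈ Finset.range M, a m - P ≤ (weilQuadraticChar χ g).re := fun M ↦ by
    have h := re_weilQuadraticChar_ge_trivialKeyFormTrunc_quarter hq χ hg hsupp hN M
    simp only [trivialKeyFormTrunc] at h
    exact h
  have hF0 : F 0 = 0 := by
    simp only [hF, sub_zero, hN2]
    rw [sub_eq_zero]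
    exact integral_congr_ae (Eventually.of_forall fun y ↦ by simp only; ring)
  have hFnn : ∀ u, 0 ≤ F u := fun u ↦ sub_nonneg.2 (integral_norm_mul_norm_shift_le hg u)
  have hFle : ∀ u, F u ≤ N2 := fun u ↦ by
    simp only [hF]; linarith [integral_norm_mul_norm_shift_nonneg g u]
  have hFm : Measurable F := measurable_const.sub (stronglyMeasurable_integral_norm_mul_norm_shift hg).measurable
  have hEc : ∀ m : ℕ, Continuous fun u : ℝ ↦ Real.exp (-(2 * ((m : ℝ) + 1 / 4) * |u|)) := fun m ↦
    Real.continuous_exp.comp ((continuous_const.mul continuous_abs).neg)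
  have hfI : ∀ m : ℕ, Integrable fun u : ℝ ↦ Real.exp (-(2 * ((m : ℝ) + 1 / 4) * |u|)) * F u := by
    intro m
    refine ((integrable_exp_neg_mul_abs (by positivity : 0 < 2 * ((m : ℝ) + 1 / 4))).mul_const N2).mono'
      ((hEc m).measurable.mul hFm).aestronglyMeasurable (Eventually.of_forall fun u ↦ ?_)
    rw [Real.norm_of_nonneg (mul_nonneg (Real.exp_pos _).le (hFnn u))]
    exact mul_le_mul_of_nonneg_left (hFle u) (Real.exp_pos _).le
  have hann : ∀ m, 0 ≤ a m := fun m ↦ integral_nonneg fun u ↦ mul_nonneg (Real.exp_pos _).le (hFnn u)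
  have hbound : ∀ M, ∑ m ∈ Finset.range M, a m ≤ (weilQuadraticChar χ g).re - C + P := fun M ↦ by
    linarith [hT M]
  have hsum : Summable a := summable_of_sum_range_le hann hbound
  have hnorm : ∀ m : ℕ, ∫ u : ℝ, ‖Real.exp (-(2 * ((m : ℝ) + 1 / 4) * |u|)) * F u‖ = a m := fun m ↦
    integral_congr_ae (Eventually.of_forall fun u ↦ by
      simp only; rw [Real.norm_of_nonneg (mul_nonneg (Real.exp_pos _).le (hFnn u))])
  have hsum' : Summable fun m : ℕ ↦ ∫ u : ℝ, ‖Real.exp (-(2 * ((m : ℝ) + 1 / 4) * |u|)) * F u‖ := by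
    simp_rw [hnorm]; exact hsum
  have hx1 := integral_tsum_of_summable_integral_norm hfI hsum'
  have hptw : ∀ u : ℝ, ∑' m : ℕ, Real.exp (-(2 * ((m : ℝ) + 1 / 4) * |u|)) * F u = levyDensity (1 / 4) u * F u :=
    fun u ↦ (hasSum_layers_mul (1 / 4) hF0 u).tsum_eq
  simp_rw [hptw] at hx1
  have hlim : Tendsto (fun M : ℕ ↦ ∑ m ∈ Finset.range M, a m) atTop (𝓝 (∫ u : ℝ, levyDensity (1 / 4) u * F u)) := by
    rw [← hx1]
    exact hsum.hasSum.tendsto_sum_nat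
  have hle : C + (∫ u : ℝ, levyDensity (1 / 4) u * F u) - P ≤ (weilQuadraticChar χ g).re := by
    have hlim2 : Tendsto (fun M : ℕ ↦ C + ∑ m ∈ Finset.range M, a m - P) atTop
        (𝓝 (C + (∫ u : ℝ, levyDensity (1 / 4) u * F u) - P)) :=
      (tendsto_const_nhds.add hlim).sub tendsto_const_nhds
    exact le_of_tendsto' hlim2 hT
  simp only [trivialKeyForm]
  exact hle

/-- **ONE EVEN PSEUDO-KEY CERTIFICATE ⇒ EVERY CHARACTER OF EVERY LARGER MODULUS.**  If Weil's even all-trivial-key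
form at conductor parameter `Q₀` is non-negative at `|g|` for every test function `g` supported in `[-t, t]`, then
`WeilPositivityOnChar χ t` for EVERY Dirichlet character (any parity, any values) of EVERY modulus `q ≥ Q₀`.
[cite: Weil1952FormulesExplicites, (11) and the «lemme» p. 262] -/
theorem weilPositivityOnChar_of_trivialKeyForm_quarter_nonneg {q : ℕ} (hq : q ≠ 1) (χ : DirichletCharacter ℂ q)
    {t : ℝ} {N : ℕ} (hN : Real.exp (2 * t) ≤ (N : ℝ) + 1) {Q₀ : ℕ} (hQ₀ : 0 < Q₀) (hQ : Q₀ ≤ q)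
    (hpos : ∀ g : ℝ → ℂ, IsWeilTest g → tsupport g ⊆ Icc (-t) t →
      0 ≤ trivialKeyForm (1 / 4) Q₀ N (fun y ↦ ‖g y‖)) :
    WeilPositivityOnChar χ t := by
  intro g hg hsupp
  have h1 := re_weilQuadraticChar_ge_trivialKeyForm_quarter hq χ hg hsupp hN
  have h2 := hpos g hg hsupp
  have hlog : Real.log Q₀ ≤ Real.log q :=
    Real.log_le_log (by exact_mod_cast hQ₀) (by exact_mod_cast hQ)
  have hN20 : 0 ≤ ∫ y : ℝ, ‖g y‖ ^ 2 := integral_nonneg fun _ ↦ by positivity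
  have e : trivialKeyForm (1 / 4) q N (fun y ↦ ‖g y‖) =
      trivialKeyForm (1 / 4) Q₀ N (fun y ↦ ‖g y‖) + (Real.log q - Real.log Q₀) * ∫ y : ℝ, ‖g y‖ ^ 2 := by
    unfold trivialKeyForm; ring
  rw [e] at h1
  nlinarith [mul_nonneg (sub_nonneg.2 hlog) hN20]

end UniformFloor

end Summit.Ventures.WeilGRH

end
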